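/-
Copyright (c) 2026 the pub-hodgecm-mathlib formalisation cell (harness21).  Prover seat hodgecm-mathlib-K2Liu-p13 (g4), Track B «K2-LIT»,
#184♮ = hLiu418 = `stmt-HodgeConjecture-24832`; ROAD Φ (RULING «M-156n»), #41 TOP — the END-FILE SKELETON of the (β) Euler face: how ★ (E3) `exists_eulerHead_intertwiningDelta`
(`M(s)f_s(κ) = B_T · R`), the (E6′) pure-tensor decomposition of the `T`-block integrand, ★ p862082 Fubini, the archimedean and local VALUE letters and the scalar letter
`a·R = corr` (★ p861784 + (E4)) combine — at a FIXED `s` it is pure algebra — into the `hB` of ★ p862134 `exists_bigCell_continuation_cm_of_facesSum` BYTE FOR BYTE.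
THEOREMS ONLY (no `def`, no `instance`, no named-fact hypothesis, no `sorry`).
-/
import Summits.HodgeConjecture.HodgeConjecture.Theorems.K2LiuBigCellTBlockFubini   -- ★ p862082 `integral_eq_sum_of_pureTensor`
import HarnessLib

/-!
# Crux `HLiu418`, ROAD Φ, organ Φ8 (row G6): THE EULER-FACE ASSEMBLY AT A POINT — from the Euler head, the pure-tensor slice and the value letters to `hB`

Cell `hodgecm-mathlib`, crux item hLiu418 = `stmt-HodgeConjecture-24832` (helper lane, count-neutral).  Fix `s` (so everything is a NUMBER) and a point `κ`.  Letters: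
(i) the Euler head `M = B · R`, `B = ∫ Φ d(ν_∞ ⊗ ⊗_{v∈T} ν_v)` (★ E3); (ii) the slice decomposition `Φ(p) = Σ_{i∈I} F_i(p.1)·∏_{v∈T} G_{i,v}(p.2 v)` with integrable factors ((E6′) + A7∕(H2-an)
integrability); (iii) archimedean values `∫ F_i dν_∞ = A_i` ((E8)); (iv) local values `∫ G_{i,v} dν_v = c_v · N_{i,v}` (★ A7-AllS0 after transport; `c_v` = `aNorm_v`, `N` = `Fn`);
(v) the scalar letter `a · R = corr` (`a = b^S∕a^S`, `R = ∏'_{v∉T} c_v = a^T∕b^T` by (E4) + ★ `hasProd_localScalar`, `corr = ∏_{v∈T∖S} c_v⁻¹` by ★ p861784 — or `corr` absorbed otherwise).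
THEN **`eulerFace_of_letters`**: `a · M = Σ_{i∈I} (corr · A_i) · ∏_{v∈T} (c_v · N_{i,v})` — the right-hand side of ★ p862134's `hB` with `A κ i s := corr·A_i`, `TF κ := T`.
Variant **`eulerFace_of_letters'`** with the scalar distributed into the local factors of a sub-finset `P ⊆ T` instead (`c′_v := d_v · c_v` on `P`): the (E7″) reading
(`m_v = c_v⁻¹·aNorm_v` at `v ∈ P`, `aNorm_v` at `v ∈ S_ε`).
Sources: [Tan1999, §3]; [KudlaRallis1994, §1]; [HarrisKudlaSweet1996, §6 (6.14)–(6.16)]; [BorelJacquet1979, §4.1].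
HONEST LABEL.  Helper lemmas, count-neutral; `HC_CM` is proved only modulo the 7 printed citations (2 remaining named inputs:
hLiu418 = `stmt-HodgeConjecture-24832`, h413 = `stmt-HodgeConjecture-24833`) until rung 0 closes.
-/

set_option autoImplicit false
-- the mandated namespace repeats the single-problem summit's segment (`HodgeConjecture.HodgeConjecture`)
set_option linter.dupNamespace false

noncomputable section

open MeasureTheory

namespace Summit.HodgeConjecture.HodgeConjecture.Cruxes.HLiu418.K2LiuBigCellEulerFaceAssembly

open Summit.HodgeConjecture.HodgeConjecture.Cruxes.HLiu418.K2LiuBigCellTBlockFubini (integral_eq_sum_of_pureTensor)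

variable {X : Type*} [MeasurableSpace X] {Pl : Type*} (T : Finset Pl) {Y : ↥T → Type*} [∀ v, MeasurableSpace (Y v)]
  (νinf : Measure X) [SFinite νinf] (ν : ∀ v : ↥T, Measure (Y v)) [∀ v, SigmaFinite (ν v)]

/-- reindexing a product over the subtype of a finset: `∏_{v : T} g v.1 = ∏_{v ∈ T} g v`. [folklore] -/
theorem prod_coe_sort_eq {R : Type*} [CommMonoid R] (g : Pl → R) : ∏ v : ↥T, g v.1 = ∏ v ∈ T, g v :=
  Finset.prod_coe_sort T g

/-- **THE EULER FACE AT A POINT FROM ITS LETTERS.**  `M = B·R` with `B = ∫ Φ`, `Φ = Σ_i F_i ⊗ ∏_v G_{i,v}` (integrable factors), `∫ F_i = A_i`, `∫ G_{i,v} = c_v·N_{i,v}`,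
`a·R = corr` ⟹ `a·M = Σ_{i∈I} (corr·A_i)·∏_{v∈T}(c_v·N_{i,v})`. [cite: Tan1999, §3] [cite: KudlaRallis1994, §1] [cite: HarrisKudlaSweet1996, §6 (6.14)–(6.16)] -/
theorem eulerFace_of_letters {κ' : Type*} (I : Finset κ') (F : κ' → X → ℂ) (G : κ' → ∀ v : ↥T, Y v → ℂ)
    (hF : ∀ i ∈ I, Integrable (F i) νinf) (hG : ∀ i ∈ I, ∀ v, Integrable (G i v) (ν v))
    (Φ : X × (∀ v : ↥T, Y v) → ℂ) (hΦ : ∀ p, Φ p = ∑ i ∈ I, F i p.1 * ∏ v, G i v (p.2 v))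
    (M R : ℂ) (hM : M = (∫ p, Φ p ∂(νinf.prod (Measure.pi ν))) * R)
    (A : κ' → ℂ) (hA : ∀ i ∈ I, ∫ a, F i a ∂νinf = A i)
    (c : Pl → ℂ) (N : κ' → Pl → ℂ) (hGv : ∀ i ∈ I, ∀ v : ↥T, ∫ y, G i v y ∂(ν v) = c v.1 * N i v.1)
    (a corr : ℂ) (haR : a * R = corr) :
    a * M = ∑ i ∈ I, (corr * A i) * ∏ v ∈ T, (c v * N i v) := by
  rw [hM, integral_eq_sum_of_pureTensor νinf ν I F G hF hG Φ hΦ, mul_comm _ R, ← mul_assoc, haR, Finset.mul_sum]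
  refine Finset.sum_congr rfl fun i hi => ?_
  rw [hA i hi, ← prod_coe_sort_eq T (fun v => c v * N i v), ← mul_assoc]
  congr 1
  exact Finset.prod_congr rfl fun v _ => hGv i hi v

/-- **THE SAME WITH THE SCALAR DISTRIBUTED OVER A SUB-FINSET `P ⊆ T`**: if `corr = ∏_{v∈P} d_v` (e.g. `d_v = c_v⁻¹` of ★ p861784) then
`a·M = Σ_{i∈I} A_i · ∏_{v∈T}(c′_v·N_{i,v})` with `c′_v = d_v·c_v` on `P` and `c′_v = c_v` off `P` — the (E7″) reading (`c′_v = m_v` at the `ε`-unramified bad places,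
`aNorm_v` at `v ∈ S_ε`). [cite: Tan1999, §3] [cite: HarrisKudlaSweet1996, §6 (6.16)] -/
theorem eulerFace_of_letters' [DecidableEq Pl] {κ' : Type*} (I : Finset κ') (F : κ' → X → ℂ) (G : κ' → ∀ v : ↥T, Y v → ℂ)
    (hF : ∀ i ∈ I, Integrable (F i) νinf) (hG : ∀ i ∈ I, ∀ v, Integrable (G i v) (ν v))
    (Φ : X × (∀ v : ↥T, Y v) → ℂ) (hΦ : ∀ p, Φ p = ∑ i ∈ I, F i p.1 * ∏ v, G i v (p.2 v))
    (M R : ℂ) (hM : M = (∫ p, Φ p ∂(νinf.prod (Measure.pi ν))) * R)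
    (A : κ' → ℂ) (hA : ∀ i ∈ I, ∫ a, F i a ∂νinf = A i)
    (c : Pl → ℂ) (N : κ' → Pl → ℂ) (hGv : ∀ i ∈ I, ∀ v : ↥T, ∫ y, G i v y ∂(ν v) = c v.1 * N i v.1)
    (P : Finset Pl) (hPT : P ⊆ T) (d : Pl → ℂ) (a : ℂ) (haR : a * R = ∏ v ∈ P, d v) :
    a * M = ∑ i ∈ I, A i * ∏ v ∈ T, ((if v ∈ P then d v * c v else c v) * N i v) := by
  rw [eulerFace_of_letters T νinf ν I F G hF hG Φ hΦ M R hM A hA c N hGv a _ haR]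
  refine Finset.sum_congr rfl fun i _ => ?_
  -- `∏_{v∈T} (c′_v N) = (∏_{v∈P} d_v) · ∏_{v∈T} (c_v N)`
  have hsplit : ∏ v ∈ T, ((if v ∈ P then d v * c v else c v) * N i v) = (∏ v ∈ P, d v) * ∏ v ∈ T, (c v * N i v) := by
    rw [← Finset.prod_sdiff hPT, ← Finset.prod_sdiff hPT (f := fun v => c v * N i v)]
    have h1 : ∏ v ∈ T \ P, ((if v ∈ P then d v * c v else c v) * N i v) = ∏ v ∈ T \ P, (c v * N i v) :=
      Finset.prod_congr rfl fun v hv => by rw [if_neg (Finset.mem_sdiff.1 hv).2]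
    have h2 : ∏ v ∈ P, ((if v ∈ P then d v * c v else c v) * N i v) = (∏ v ∈ P, d v) * ∏ v ∈ P, (c v * N i v) := by
      rw [← Finset.prod_mul_distrib]
      exact Finset.prod_congr rfl fun v hv => by rw [if_pos hv, mul_assoc]
    rw [h1, h2]
    ring
  rw [hsplit]
  ring

end Summit.HodgeConjecture.HodgeConjecture.Cruxes.HLiu418.K2LiuBigCellEulerFaceAssembly

end
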